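import Summits.QuantumFields.YangMills.Theorems.AllWindowsColdBoxBoxHighLineTwoFormGaussRatios
import Summits.QuantumFields.YangMills.Theorems.AllWindowsColdBoxBoxHighLineSmallFieldInsideFPSharpCore
import Summits.QuantumFields.YangMills.Theorems.AllWindowsColdBoxBoxHighLineEventInsideFPCore

/-!
# `eventInsideFP_sharp` (planner ym-idea-2 g18 (N1), ASSEMBLY-U5 v0.1 §3 (D′)) — the event domination re-based on the two-form Gaussians: CONSTANT bracket
# in the regime `s·H⁴·(1+log H) ≪ 1`, at the price `√p` (Cauchy–Schwarz)   (LINE-20 U5 ⟨stmt-QuantumFields-24336⟩; U5 prep, helper-grade; U5 OPEN)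

Width seat `ym-line-sfw-p2-w4` (prover-ym-line-sfw-p2-w4-g29-0).  ✓`SmallFieldFP.eventInsideFP` carries the bracket `e^{C·s·H⁵}` (relative sandwich 6a at scale `s`),
unbounded near `θ = 1/10`.  Here the sandwich is the SHARP one (✓6a′ `abs_action_sub_boxQuadForm_le_sharp`, `δ = C₆·s`, no Poincaré `H`) and the comparison
Gaussians are the two-form Gaussians `e^{−β((1∓δ)Q ∓ δN)}` (✓`TwoFormGauss.*`); the event probability under the MINUS Gaussian is converted into the ordinary
chart-Gaussian probability `gaussAvg (β(1−δ)) 1_A ≤ p` by Cauchy–Schwarz (✓`setIntegral_exp_twoFormMinus_le_sqrt`), and every normaliser ratio is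
`exp((15+27C₃)δn/2) ≤ e` in the regime `C·s·H⁴ ≤ 1` (✓`integral_exp_*_le_twoFormPlus`); the determinant ratio is ✓h6b′ `ghostDetRatio_sq_le` at scale `s`
(`e^{K₇H⁴(1+log H)⁴s²} ≤ e^{16K₇⁺}` since `(1+log H)⁴ ≤ 16H²` and `s·H² ≤ c₀ ≤ 1`, `s·H⁴ ≤ 1`):

  ★★ **`SmallFieldFPSharp.eventInsideFP_sharp`**: `∃ C c₀ c₁, 0 < c₀ ∧ 0 < c₁ ∧ ∀ H ≥ 1, ∀ β r s, 0 < β → 0 < s → s ≤ r → s·H² ≤ c₀ → C(1+log H) ≤ βs² →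
  s·H⁴ ≤ c₀ → ∀ A measurable, ∀ p, 0 ≤ p → p ≤ c₁ → (∀ β′, β/2 ≤ β′ → β′ ≤ 2β → gaussAvg β′ H 1_A ≤ p) → ∫_{smallField s ∩ A} w_J ≤ C·√p·∫_{smallField (s/2) ∖ A} w_J`
  (`c₁ = 1/12`; `smallField (s/2) ∖ A ⊆ smallField s ∖ A`, so the `D ∖ A` form follows by monotonicity as in ✓`eventInsideFP_both`).

In U5 letters `s·H⁴ = β^{κ₃+4θ−1/2} → 0` ⟺ (K4) `κ₃ + 4θ < 1/2` (constraint of record), so a FIXED moment order `k` in w5's tail makes `√p_k` polynomially small.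
Everything proved; no definitions; standard axioms.  HONEST LABEL: U5 prep, helper-grade; U5 ⟨24336⟩, ⟨24004⟩ and the seat's own crux ⟨22884⟩ remain OPEN; no stub is closed by
name, no crux, rung or summit is proved; **the Yang–Mills mass gap is NOT proved by this file; no summit is proved by a line.**
-/

set_option autoImplicit false

open MeasureTheory Real Finset

namespace Summit.QuantumFields.YangMills.Theorems.AllWindowsColdBoxBoxHighLine

namespace SmallFieldFPSharp

open SmallFieldFP TwoFormGauss

variable {H : ℕ}

/-! ## The two integral bounds on the event (two-form letters) -/

/-- **NUMERATOR on the event**: sharp sandwich `|W+Φ−Q| ≤ δ(Q+N)` and `|det F| ≤ K·D₀` on `smallField T`, `s ≤ T`: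
`∫_{smallField s ∩ A} w ≤ K·D₀·((2π²)⁻¹)^n · ∫_A e^{−β((1−δ)Q − δN)}`. -/
theorem setIntegral_inter_le_sharp (hH : 1 ≤ H) {β s T δ K D₀ : ℝ} (hβ : 0 < β) (hsT : s ≤ T) (hδ0 : 0 ≤ δ) (hδ : 1376 * (H : ℝ) ^ 2 * δ ≤ 1)
    (hK : 0 ≤ K) (hD₀ : 0 ≤ D₀)
    (hsand : ∀ a : LandauFree H → E3, (∀ e, ‖a e‖ ≤ T) →
      |boxWilson H (edgeChart H a) + landauPhi H (edgeChart H a) - boxQuadForm H a| ≤ δ * (boxQuadForm H a + ∑ e, ‖a e‖ ^ 2))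
    (hdet : ∀ a : LandauFree H → E3, a ∈ smallField H T → |(fpOperator H (edgeChart H a)).det| ≤ K * D₀)
    (r : ℝ) {A : Set (LandauFree H → E3)} (hA : MeasurableSet A) :
    ∫ a in smallField H s ∩ A, fpChartWeight β H r a ≤
      K * D₀ * (1 / (2 * Real.pi ^ 2)) ^ Fintype.card (LandauFree H) *
        ∫ a in A, Real.exp (-(β * ((1 - δ) * boxQuadForm H a - δ * ∑ e, ‖a e‖ ^ 2))) := by
  have hpow : 0 ≤ (1 / (2 * Real.pi ^ 2)) ^ Fintype.card (LandauFree H) := by positivity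
  have hM : 0 ≤ K * D₀ * (1 / (2 * Real.pi ^ 2)) ^ Fintype.card (LandauFree H) := mul_nonneg (mul_nonneg hK hD₀) hpow
  have hS : MeasurableSet (smallField H s ∩ A) := (ChartGauss.measurableSet_smallField s).inter hA
  have hlow : ∀ a : LandauFree H → E3, a ∈ smallField H T →
      (1 - δ) * boxQuadForm H a - δ * ∑ e, ‖a e‖ ^ 2 ≤ boxWilson H (edgeChart H a) + landauPhi H (edgeChart H a) := by
    intro a ha
    have h := (abs_le.1 (hsand a ha)).1
    linarith
  have hptw : ∀ a : LandauFree H → E3, (smallField H s ∩ A).indicator (fpChartWeight β H r) a ≤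
      K * D₀ * (1 / (2 * Real.pi ^ 2)) ^ Fintype.card (LandauFree H) *
        A.indicator (fun a => Real.exp (-(β * ((1 - δ) * boxQuadForm H a - δ * ∑ e, ‖a e‖ ^ 2)))) a := by
    intro a
    by_cases ha : a ∈ smallField H s ∩ A
    · rw [Set.indicator_of_mem ha, Set.indicator_of_mem ha.2]
      have hb : a ∈ smallField H T := fun e => (ha.1 e).trans hsT
      calc fpChartWeight β H r a ≤ |(fpOperator H (edgeChart H a)).det| * (1 / (2 * Real.pi ^ 2)) ^ Fintype.card (LandauFree H) *
            Real.exp (-(β * ((1 - δ) * boxQuadForm H a - δ * ∑ e, ‖a e‖ ^ 2))) := fpChartWeight_le_of_lower hβ.le hlow r hb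
        _ ≤ K * D₀ * (1 / (2 * Real.pi ^ 2)) ^ Fintype.card (LandauFree H) *
            Real.exp (-(β * ((1 - δ) * boxQuadForm H a - δ * ∑ e, ‖a e‖ ^ 2))) :=
            mul_le_mul_of_nonneg_right (mul_le_mul_of_nonneg_right (hdet a hb) hpow) (Real.exp_pos _).le
    · rw [Set.indicator_of_notMem ha]
      exact mul_nonneg hM (Set.indicator_nonneg (fun _ _ => (Real.exp_pos _).le) _)
  have hgi := integrable_exp_twoFormMinus hH hβ hδ0 hδ
  have hupper : Integrable fun a : LandauFree H → E3 => K * D₀ * (1 / (2 * Real.pi ^ 2)) ^ Fintype.card (LandauFree H) *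
      A.indicator (fun a => Real.exp (-(β * ((1 - δ) * boxQuadForm H a - δ * ∑ e, ‖a e‖ ^ 2)))) a :=
    (hgi.indicator hA).const_mul _
  rw [← integral_indicator hS]
  calc ∫ a, (smallField H s ∩ A).indicator (fpChartWeight β H r) a
      ≤ ∫ a, K * D₀ * (1 / (2 * Real.pi ^ 2)) ^ Fintype.card (LandauFree H) *
          A.indicator (fun a => Real.exp (-(β * ((1 - δ) * boxQuadForm H a - δ * ∑ e, ‖a e‖ ^ 2)))) a :=
        integral_mono_of_nonneg (ae_of_all _ fun a => Set.indicator_nonneg (fun _ _ => FPChart.fpChartWeight_nonneg β r _) _)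
          hupper (ae_of_all _ hptw)
    _ = K * D₀ * (1 / (2 * Real.pi ^ 2)) ^ Fintype.card (LandauFree H) *
          ∫ a in A, Real.exp (-(β * ((1 - δ) * boxQuadForm H a - δ * ∑ e, ‖a e‖ ^ 2))) := by
        rw [integral_const_mul, integral_indicator hA]

/-- **DENOMINATOR off the event**: with the sharp sandwich at level `T`, the two-sided determinant comparison on `smallField T`, a relative sandwich (for
integrability), `0 ≤ t ≤ min(T,r,1)`:  `K⁻¹·D₀·((2π²)⁻¹)^n·e^{−n(t²/3+t⁴)}·(∫_{smallField t} e^{−β((1+δ)Q+δN)} − ∫_A e^{−βQ}) ≤ ∫_{smallField t ∖ A} w`. -/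
theorem le_setIntegral_smallField_diff_sharp (hH : 1 ≤ H) {β r t T δ ε K D₀ : ℝ} (hβ : 0 < β) (hr : 0 < r) (ht0 : 0 ≤ t) (htr : t ≤ r)
    (ht1 : t ≤ 1) (htT : t ≤ T) (hδ0 : 0 ≤ δ) (hε1 : ε ≤ 1) (hK : 0 < K) (hD₀ : 0 ≤ D₀)
    (hsand : ∀ a : LandauFree H → E3, (∀ e, ‖a e‖ ≤ T) →
      |boxWilson H (edgeChart H a) + landauPhi H (edgeChart H a) - boxQuadForm H a| ≤ δ * (boxQuadForm H a + ∑ e, ‖a e‖ ^ 2))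
    (hsandRel : ∀ a : LandauFree H → E3, (∀ e, ‖a e‖ ≤ T) →
      |boxWilson H (edgeChart H a) + landauPhi H (edgeChart H a) - boxQuadForm H a| ≤ ε * boxQuadForm H a)
    (hdet : ∀ a : LandauFree H → E3, a ∈ smallField H T →
      |(fpOperator H (edgeChart H a)).det| ≤ K * D₀ ∧ D₀ ≤ K * |(fpOperator H (edgeChart H a)).det|)
    {A : Set (LandauFree H → E3)} (hA : MeasurableSet A) :
    K⁻¹ * D₀ * ((1 / (2 * Real.pi ^ 2)) ^ Fintype.card (LandauFree H) * Real.exp (-(Fintype.card (LandauFree H) * (t ^ 2 / 3 + t ^ 4)))) *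
        ((∫ a in smallField H t, Real.exp (-(β * ((1 + δ) * boxQuadForm H a + δ * ∑ e, ‖a e‖ ^ 2)))) -
          ∫ a in A, Real.exp (-(β * boxQuadForm H a))) ≤
      ∫ a in smallField H t \ A, fpChartWeight β H r a := by
  have hup : ∀ a : LandauFree H → E3, a ∈ smallField H t →
      boxWilson H (edgeChart H a) + landauPhi H (edgeChart H a) ≤ (1 + δ) * boxQuadForm H a + δ * ∑ e, ‖a e‖ ^ 2 := by
    intro a ha
    have h := (abs_le.1 (hsand a fun e => (ha e).trans htT)).2
    linarith
  set c : ℝ := K⁻¹ * D₀ * ((1 / (2 * Real.pi ^ 2)) ^ Fintype.card (LandauFree H) *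
    Real.exp (-(Fintype.card (LandauFree H) * (t ^ 2 / 3 + t ^ 4)))) with hc
  have hc0 : 0 ≤ c := by rw [hc]; positivity
  have hptw : ∀ a ∈ smallField H t \ A, c * Real.exp (-(β * ((1 + δ) * boxQuadForm H a + δ * ∑ e, ‖a e‖ ^ 2))) ≤ fpChartWeight β H r a := by
    intro a ha
    have haT : a ∈ smallField H T := fun e => (ha.1 e).trans htT
    have hD : K⁻¹ * D₀ ≤ |(fpOperator H (edgeChart H a)).det| := by
      rw [inv_mul_le_iff₀ hK]; exact (hdet a haT).2
    have h := le_fpChartWeight_of_upper hβ.le hr.ne' ht0 htr ht1 hup ha.1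
    refine le_trans ?_ h
    rw [hc]
    have hh : 0 ≤ (1 / (2 * Real.pi ^ 2)) ^ Fintype.card (LandauFree H) * Real.exp (-(Fintype.card (LandauFree H) * (t ^ 2 / 3 + t ^ 4))) := by
      positivity
    exact mul_le_mul_of_nonneg_right (mul_le_mul_of_nonneg_right hD hh) (Real.exp_pos _).le
  -- `∫_{smallField t ∖ A} e₊ ≥ ∫_{smallField t} e₊ − ∫_A e₊ ≥ ∫_{smallField t} e₊ − ∫_A e^{−βQ}`
  have hgi := integrable_exp_twoFormPlus (H := H) (δ := δ) hβ hδ0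
  have hg0 := ChartGauss.integrable_exp_neg_mul_boxQuadForm (H := H) hβ
  have hsplit := integral_inter_add_sdiff (μ := volume) (s := smallField H t) hA hgi.integrableOn
  have hplus_le : ∀ a : LandauFree H → E3, Real.exp (-(β * ((1 + δ) * boxQuadForm H a + δ * ∑ e, ‖a e‖ ^ 2))) ≤ Real.exp (-(β * boxQuadForm H a)) := by
    intro a
    refine Real.exp_le_exp.2 ?_
    have hQ := BoxQuadForm.boxQuadForm_nonneg hH a
    have hN : 0 ≤ ∑ e, ‖a e‖ ^ 2 := Finset.sum_nonneg fun _ _ => by positivity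
    nlinarith [mul_nonneg hδ0 hQ, mul_nonneg hδ0 hN, mul_nonneg hβ.le (mul_nonneg hδ0 (add_nonneg hQ hN))]
  have hinter : ∫ a in smallField H t ∩ A, Real.exp (-(β * ((1 + δ) * boxQuadForm H a + δ * ∑ e, ‖a e‖ ^ 2))) ≤
      ∫ a in A, Real.exp (-(β * boxQuadForm H a)) :=
    (setIntegral_mono_set hgi.integrableOn (ae_of_all _ fun a => (Real.exp_pos _).le)
      (ae_of_all _ (Set.inter_subset_right : smallField H t ∩ A ⊆ A))).trans
      (setIntegral_mono_on hgi.integrableOn hg0.integrableOn hA fun a _ => hplus_le a)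
  have hdiff : (∫ a in smallField H t, Real.exp (-(β * ((1 + δ) * boxQuadForm H a + δ * ∑ e, ‖a e‖ ^ 2)))) -
      ∫ a in A, Real.exp (-(β * boxQuadForm H a)) ≤
      ∫ a in smallField H t \ A, Real.exp (-(β * ((1 + δ) * boxQuadForm H a + δ * ∑ e, ‖a e‖ ^ 2))) := by
    linarith
  have hwi : IntegrableOn (fpChartWeight β H r) (smallField H t \ A) :=
    (integrableOn_fpChartWeight_smallField hH hβ.le hε1 hK.le hD₀ hsandRel (fun a ha => (hdet a ha).1) r ht0 htT).mono_set
      Set.sdiff_subset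
  calc c * ((∫ a in smallField H t, Real.exp (-(β * ((1 + δ) * boxQuadForm H a + δ * ∑ e, ‖a e‖ ^ 2)))) -
          ∫ a in A, Real.exp (-(β * boxQuadForm H a)))
      ≤ c * ∫ a in smallField H t \ A, Real.exp (-(β * ((1 + δ) * boxQuadForm H a + δ * ∑ e, ‖a e‖ ^ 2))) :=
        mul_le_mul_of_nonneg_left hdiff hc0
    _ = ∫ a in smallField H t \ A, c * Real.exp (-(β * ((1 + δ) * boxQuadForm H a + δ * ∑ e, ‖a e‖ ^ 2))) := (integral_const_mul _ _).symm
    _ ≤ ∫ a in smallField H t \ A, fpChartWeight β H r a :=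
        setIntegral_mono_on (hgi.integrableOn.const_mul c) hwi ((ChartGauss.measurableSet_smallField t).diff hA) hptw

/-! ## Assembly -/

/-- **Ratio assembly for the sharp event bound** (opaque reals). -/
theorem sharp_event_assembly {Inum Iden K D₀ P g Zp Icomp IA1 Z1 Zm2 Ibox IA Z0 M p q : ℝ}
    (hK : 0 < K) (hD₀ : 0 ≤ D₀) (hP : 0 < P) (hZp : 0 < Zp) (hp : 0 ≤ p) (hM : 0 ≤ M)
    (hU : Inum ≤ K * D₀ * P * Icomp) (hCS : Icomp ≤ Real.sqrt IA1 * Real.sqrt Zm2)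
    (hA1 : IA1 ≤ p * Z1) (hZ1 : Z1 ≤ M * Zp) (hZm2' : Zm2 ≤ M * Zp)
    (hL : K⁻¹ * D₀ * (P * Real.exp (-g)) * (Ibox - IA) ≤ Iden) (hIA : IA ≤ p * Z0) (hZ0 : Z0 ≤ M * Zp)
    (hbox : (1 - q) * Zp ≤ Ibox) (hq : q ≤ 1 / 4) (hpM : p * M ≤ 1 / 4) :
    Inum ≤ (2 * K ^ 2 * Real.exp g * M * Real.sqrt p) * Iden := by
  set G : ℝ := Real.exp g with hGdef
  have hG : 0 < G := Real.exp_pos _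
  have hGinv : Real.exp (-g) = G⁻¹ := by rw [Real.exp_neg]
  rw [hGinv] at hL
  -- numerator: `Icomp ≤ M √p Zp`
  have h1 : Real.sqrt IA1 ≤ Real.sqrt p * Real.sqrt (M * Zp) := by
    rw [← Real.sqrt_mul hp]
    exact Real.sqrt_le_sqrt (hA1.trans (mul_le_mul_of_nonneg_left hZ1 hp))
  have h2 : Real.sqrt Zm2 ≤ Real.sqrt (M * Zp) := Real.sqrt_le_sqrt hZm2'
  have hMZ : Real.sqrt (M * Zp) * Real.sqrt (M * Zp) = M * Zp := Real.mul_self_sqrt (mul_nonneg hM hZp.le)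
  have hIcomp : Icomp ≤ M * Real.sqrt p * Zp := by
    calc Icomp ≤ Real.sqrt IA1 * Real.sqrt Zm2 := hCS
      _ ≤ (Real.sqrt p * Real.sqrt (M * Zp)) * Real.sqrt (M * Zp) :=
          mul_le_mul h1 h2 (Real.sqrt_nonneg _) (mul_nonneg (Real.sqrt_nonneg _) (Real.sqrt_nonneg _))
      _ = M * Real.sqrt p * Zp := by rw [mul_assoc, hMZ]; ring
  have hnum : Inum ≤ K * D₀ * P * (M * Real.sqrt p * Zp) :=
    hU.trans (mul_le_mul_of_nonneg_left hIcomp (mul_nonneg (mul_nonneg hK.le hD₀) hP.le))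
  -- denominator: `Iden ≥ K⁻¹ D₀ P G⁻¹ Zp/2`
  have hc : 0 ≤ K⁻¹ * D₀ * (P * G⁻¹) := mul_nonneg (mul_nonneg (inv_nonneg.mpr hK.le) hD₀) (mul_nonneg hP.le (inv_nonneg.mpr hG.le))
  have hden : K⁻¹ * D₀ * (P * G⁻¹) * (1 / 2 * Zp) ≤ Iden := by
    refine le_trans (mul_le_mul_of_nonneg_left ?_ hc) hL
    have hIA' : IA ≤ 1 / 4 * Zp := hIA.trans ((mul_le_mul_of_nonneg_left hZ0 hp).trans (by nlinarith))
    have h3 : 0 ≤ (1 / 4 - q) * Zp := mul_nonneg (by linarith) hZp.le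
    nlinarith
  have hid : K * D₀ * P * (M * Real.sqrt p * Zp) = (2 * K ^ 2 * G * M * Real.sqrt p) * (K⁻¹ * D₀ * (P * G⁻¹) * (1 / 2 * Zp)) := by
    field_simp
  have hB : 0 ≤ 2 * K ^ 2 * G * M * Real.sqrt p := by positivity
  calc Inum ≤ K * D₀ * P * (M * Real.sqrt p * Zp) := hnum
    _ = (2 * K ^ 2 * G * M * Real.sqrt p) * (K⁻¹ * D₀ * (P * G⁻¹) * (1 / 2 * Zp)) := hid
    _ ≤ (2 * K ^ 2 * G * M * Real.sqrt p) * Iden := mul_le_mul_of_nonneg_left hden hB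

/-- Arithmetic (opaque reals): the mass-ratio exponent in the regime `s·H⁴ ≤ c₀`. -/
theorem m_exponent_aux {n X s a : ℝ} (ha : 0 ≤ a) (hs : 0 ≤ s) (hn : n ≤ 216 * X) :
    a * s * n / 2 ≤ a * 108 * (s * X) := by
  nlinarith [mul_le_mul_of_nonneg_left hn (mul_nonneg ha hs)]

/-- Arithmetic (opaque reals): the determinant exponent `H⁴(1+log H)⁴s² ≤ 16` when `(1+log H)⁴ ≤ 16H²`, `sH² ≤ c₀`, `sH⁴ ≤ c₀ ≤ 1`. -/
theorem k_exponent_aux {X L s c₀ : ℝ} (hs : 0 ≤ s) (hL4 : L ^ 4 ≤ 16 * X ^ 2) (h2 : s * X ^ 2 ≤ c₀)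
    (h4 : s * X ^ 4 ≤ c₀) (hc₀0 : 0 ≤ c₀) (hc₀1 : c₀ ≤ 1) : X ^ 4 * L ^ 4 * s ^ 2 ≤ 16 := by
  have h1 : X ^ 4 * L ^ 4 * s ^ 2 ≤ 16 * ((s * X ^ 2) * (s * X ^ 4)) := by
    nlinarith [mul_le_mul_of_nonneg_left hL4 (by positivity : (0:ℝ) ≤ X ^ 4 * s ^ 2)]
  have h3 : (s * X ^ 2) * (s * X ^ 4) ≤ 1 := by
    calc (s * X ^ 2) * (s * X ^ 4) ≤ c₀ * c₀ := mul_le_mul h2 h4 (by positivity) hc₀0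
      _ ≤ 1 := by nlinarith
  nlinarith

/-- Arithmetic (opaque reals): the Haar exponent `n((s/2)²/3 + (s/2)⁴) ≤ 216` when `n ≤ 216H⁴`, `s ≤ 1`, `sH⁴ ≤ 1`, `H ≥ 1`. -/
theorem g_exponent_aux {n X s : ℝ} (hn : n ≤ 216 * X ^ 4) (hs0 : 0 ≤ s) (hs1 : s ≤ 1) (hsX : s * X ^ 4 ≤ 1) (hX : 1 ≤ X) :
    n * ((s / 2) ^ 2 / 3 + (s / 2) ^ 4) ≤ 216 := by
  have hφ : (s / 2) ^ 2 / 3 + (s / 2) ^ 4 ≤ s ^ 2 := by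
    have h4 : (s / 2) ^ 4 ≤ (s / 2) ^ 2 := by
      have : (s / 2) ^ 4 = (s / 2) ^ 2 * (s / 2) ^ 2 := by ring
      rw [this]; exact mul_le_of_le_one_left (sq_nonneg _) (by nlinarith)
    nlinarith [sq_nonneg s]
  have hX4 : 1 ≤ X ^ 4 := one_le_pow₀ hX
  have hφ0 : 0 ≤ (s / 2) ^ 2 / 3 + (s / 2) ^ 4 := by positivity
  calc n * ((s / 2) ^ 2 / 3 + (s / 2) ^ 4) ≤ 216 * X ^ 4 * s ^ 2 := mul_le_mul hn hφ hφ0 (by positivity)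
    _ ≤ 216 := by nlinarith [mul_nonneg hs0 (sub_nonneg.2 hs1)]

/-- ★★ **`eventInsideFP_sharp`** — the event domination with a CONSTANT bracket in the regime `s·H⁴ ≤ c₀` (price `√p`). -/
theorem eventInsideFP_sharp :
    ∃ C c₀ c₁ : ℝ, 0 < c₀ ∧ 0 < c₁ ∧ ∀ H : ℕ, 1 ≤ H → ∀ β r s : ℝ, 0 < β → 0 < s → s ≤ r → s * (H : ℝ) ^ 2 ≤ c₀ →
      C * (1 + Real.log H) ≤ β * s ^ 2 → s * (H : ℝ) ^ 4 ≤ c₀ →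
      ∀ A : Set (LandauFree H → E3), MeasurableSet A → ∀ p : ℝ, 0 ≤ p → p ≤ c₁ →
        (∀ β' : ℝ, β / 2 ≤ β' → β' ≤ 2 * β → gaussAvg β' H (A.indicator fun _ => (1 : ℝ)) ≤ p) →
        ∫ a in smallField H s ∩ A, fpChartWeight β H r a ≤
          C * Real.sqrt p * ∫ a in smallField H (s / 2) \ A, fpChartWeight β H r a := by
  obtain ⟨C₆, hC₆, h6⟩ := abs_action_sub_boxQuadForm_le_sharp
  obtain ⟨K₇, c₇, hc₇, h7⟩ := ghostDetRatio_sq_le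
  obtain ⟨C₃', hC₃'⟩ := landauVarianceBounded
  set K₇p := max K₇ 0 with hK₇p
  set C₃ := max C₃' 1 with hC₃def
  have hK₇p0 : 0 ≤ K₇p := le_max_right _ _
  have hC₃ : 1 ≤ C₃ := le_max_right _ _
  have hC₃pos : 0 < C₃ := by linarith
  -- constants: `c₀` small, `C = max(bracket, 288 C₃)`, `c₁ = 1/8`
  set E₀ : ℝ := (15 + 27 * C₃) * C₆ * 108 with hE₀
  have hE₀pos : 0 < E₀ := by positivity
  set c₀ : ℝ := min (min c₇ (1 / (2752 * C₆))) (min (1 / (4 * E₀)) 1) with hc₀def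
  have hc₀pos : 0 < c₀ := by
    rw [hc₀def]; exact lt_min (lt_min hc₇ (by positivity)) (lt_min (by positivity) one_pos)
  have hc₀7 : c₀ ≤ c₇ := (min_le_left _ _).trans (min_le_left _ _)
  have hc₀δ : c₀ ≤ 1 / (2752 * C₆) := (min_le_left _ _).trans (min_le_right _ _)
  have hc₀E : c₀ ≤ 1 / (4 * E₀) := (min_le_right _ _).trans (min_le_left _ _)
  have hc₀1 : c₀ ≤ 1 := (min_le_right _ _).trans (min_le_right _ _)
  set Cst : ℝ := 2 * Real.exp (K₇p * 16) ^ 2 * Real.exp 216 * 3 + 288 * C₃ with hCst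
  refine ⟨Cst, c₀, 1 / 12, hc₀pos, by norm_num, ?_⟩
  intro H hH β r s hβpos hs hsr hsH hCβ hsH4 A hA p hp0 hp8 hgauss
  have hH' : (1 : ℝ) ≤ H := by exact_mod_cast hH
  have hlog : 0 ≤ Real.log H := Real.log_nonneg hH'
  have hH2 : (1 : ℝ) ≤ (H : ℝ) ^ 2 := one_le_pow₀ hH'
  have hr : 0 < r := lt_of_lt_of_le hs hsr
  have hsc : s ≤ c₀ := le_trans (le_mul_of_one_le_right hs.le hH2) hsH
  have hs1 : s ≤ 1 := hsc.trans hc₀1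
  have hsH7 : s * (H : ℝ) ^ 2 ≤ c₇ := hsH.trans hc₀7
  have hvar : ∀ e : LandauFree H, (hodgeQ H)⁻¹ e e ≤ C₃ := fun e => (hC₃' H hH e).trans (le_max_left _ _)
  -- `δ = C₆ s`, window `2752 H² δ ≤ 1`
  have hδ0 : 0 ≤ C₆ * s := by positivity
  have hδw : 2752 * (H : ℝ) ^ 2 * (C₆ * s) ≤ 1 := by
    have h1 : 2752 * C₆ * (s * (H : ℝ) ^ 2) ≤ 2752 * C₆ * c₀ := mul_le_mul_of_nonneg_left hsH (by positivity)
    have h2 : 2752 * C₆ * c₀ ≤ 1 := by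
      have h := (le_div_iff₀ (by positivity : (0:ℝ) < 2752 * C₆)).1 hc₀δ
      linarith only [h, mul_comm (2752 * C₆) c₀]
    calc 2752 * (H : ℝ) ^ 2 * (C₆ * s) = 2752 * C₆ * (s * (H : ℝ) ^ 2) := by ring
      _ ≤ 1 := h1.trans h2
  obtain ⟨hδ1376, h2δ1376, -, -, hδ12⟩ := window_aux hH hδ0 hδw
  -- sandwiches at level `s`
  have hsand : ∀ a : LandauFree H → E3, (∀ e, ‖a e‖ ≤ s) →
      |boxWilson H (edgeChart H a) + landauPhi H (edgeChart H a) - boxQuadForm H a| ≤ C₆ * s * (boxQuadForm H a + ∑ e, ‖a e‖ ^ 2) :=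
    fun a ha => h6 H hH s hs.le hs1 a ha
  have hsandRel : ∀ a : LandauFree H → E3, (∀ e, ‖a e‖ ≤ s) →
      |boxWilson H (edgeChart H a) + landauPhi H (edgeChart H a) - boxQuadForm H a| ≤ C₆ * s * (1 + 344 * (H : ℝ) ^ 2) * boxQuadForm H a := by
    intro a ha
    have h := hsand a ha
    have hN := BoxQuadForm.sum_norm_sq_le_boxQuadForm hH a
    have hQ := BoxQuadForm.boxQuadForm_nonneg hH a
    refine h.trans ?_
    have : boxQuadForm H a + ∑ e, ‖a e‖ ^ 2 ≤ (1 + 344 * (H : ℝ) ^ 2) * boxQuadForm H a := by linarith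
    calc C₆ * s * (boxQuadForm H a + ∑ e, ‖a e‖ ^ 2) ≤ C₆ * s * ((1 + 344 * (H : ℝ) ^ 2) * boxQuadForm H a) :=
          mul_le_mul_of_nonneg_left this hδ0
      _ = C₆ * s * (1 + 344 * (H : ℝ) ^ 2) * boxQuadForm H a := by ring
  have hε1 : C₆ * s * (1 + 344 * (H : ℝ) ^ 2) ≤ 1 := by nlinarith [hδ1376, hδ0, hH2]
  -- determinant comparison at level `s` (h6b′), base point `0`
  set K : ℝ := Real.exp (K₇p * (H : ℝ) ^ 4 * (1 + Real.log H) ^ 4 * s ^ 2) with hKdef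
  have hK : 0 < K := Real.exp_pos _
  set D₀ : ℝ := |(fpOperator H (edgeChart H 0)).det| with hD₀def
  have hD₀ : 0 ≤ D₀ := abs_nonneg _
  have h0mem : (0 : LandauFree H → E3) ∈ smallField H s := fun e => by simp [hs.le]
  have hKle : Real.exp (K₇ * (H : ℝ) ^ 4 * (1 + Real.log H) ^ 4 * s ^ 2) ≤ K :=
    Real.exp_le_exp.2 (mul_le_mul_of_nonneg_right (mul_le_mul_of_nonneg_right
      (mul_le_mul_of_nonneg_right (le_max_left _ _) (by positivity)) (by positivity)) (sq_nonneg _))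
  have hdet : ∀ a : LandauFree H → E3, a ∈ smallField H s →
      |(fpOperator H (edgeChart H a)).det| ≤ K * D₀ ∧ D₀ ≤ K * |(fpOperator H (edgeChart H a)).det| := by
    intro a ha
    constructor
    · exact (h7 H hH _ hs.le hsH7 a 0 ha h0mem).trans (mul_le_mul_of_nonneg_right hKle hD₀)
    · exact (h7 H hH _ hs.le hsH7 0 a h0mem ha).trans (mul_le_mul_of_nonneg_right hKle (abs_nonneg _))
  clear_value D₀
  clear h6 h7 hC₃'
  -- the integral bounds
  have hU := setIntegral_inter_le_sharp hH (s := s) hβpos le_rfl hδ0 hδ1376 hK.le hD₀ hsand (fun a ha => (hdet a ha).1) r hA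
  have ht0 : 0 ≤ s / 2 := by linarith only [hs]
  have htr : s / 2 ≤ r := by linarith only [hs, hsr]
  have ht1 : s / 2 ≤ 1 := by linarith only [hs, hs1]
  have htT : s / 2 ≤ s := by linarith only [hs]
  have hL := le_setIntegral_smallField_diff_sharp hH hβpos hr ht0 htr ht1 htT hδ0 hε1 hK hD₀ hsand hsandRel hdet hA
  have hCS := setIntegral_exp_twoFormMinus_le_sqrt hH (δ := C₆ * s) hβpos hδ0 hδw hA
  have hR1 := integral_exp_smul_le_twoFormPlus hH (δ := C₆ * s) hβpos hδ0 hδw hvar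
  have hR2 := integral_exp_le_twoFormPlus (H := H) (δ := C₆ * s) hβpos hδ0 hvar
  have hR3 := integral_exp_twoFormMinus_two_le_twoFormPlus hH (δ := C₆ * s) hβpos hδ0 hδw hvar
  have hbox := le_setIntegral_smallField_twoFormPlus (H := H) (δ := C₆ * s) hβpos hδ0 ht0 hC₃pos hvar
  have hZp := integral_exp_twoFormPlus_pos (H := H) (δ := C₆ * s) hβpos hδ0
  -- the Gaussian hypothesis at `β(1 − δ) ∈ [β/2, β]` and at `β`
  have hβm : 0 < β * (1 - C₆ * s) := mul_pos hβpos (by linarith)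
  have hlo_m : β / 2 ≤ β * (1 - C₆ * s) := by
    have h := mul_le_mul_of_nonneg_left (show (1 : ℝ) / 2 ≤ 1 - C₆ * s by linarith only [hδ12]) hβpos.le
    linarith only [h]
  have hhi_m : β * (1 - C₆ * s) ≤ 2 * β := by
    have h := mul_le_mul_of_nonneg_left (show 1 - C₆ * s ≤ (2 : ℝ) by linarith only [hδ0]) hβpos.le
    linarith only [h]
  have hA1 := setIntegral_gaussWeight_le_of_gaussAvg_le hβm hA (hgauss _ hlo_m hhi_m)
  have hA0 := setIntegral_gaussWeight_le_of_gaussAvg_le hβpos hA (hgauss β (by linarith only [hβpos]) (by linarith only [hβpos]))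
  -- `M ≤ 2` in the regime `s H⁴ ≤ c₀`
  have hn := card_landauFree_le hH
  have hMle : Real.exp ((15 + 27 * C₃) * (C₆ * s) * (Fintype.card (LandauFree H) : ℝ) / 2) ≤ 3 := by
    have h1 : (15 + 27 * C₃) * (C₆ * s) * (Fintype.card (LandauFree H) : ℝ) / 2 ≤ E₀ * (s * (H : ℝ) ^ 4) := by
      have h := m_exponent_aux (a := (15 + 27 * C₃) * C₆) (X := (H : ℝ) ^ 4) (by positivity) hs.le hn
      rw [hE₀]
      calc (15 + 27 * C₃) * (C₆ * s) * (Fintype.card (LandauFree H) : ℝ) / 2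
          = (15 + 27 * C₃) * C₆ * s * (Fintype.card (LandauFree H) : ℝ) / 2 := by ring
        _ ≤ (15 + 27 * C₃) * C₆ * 108 * (s * (H : ℝ) ^ 4) := h
    have h2 : E₀ * (s * (H : ℝ) ^ 4) ≤ 1 / 4 := by
      have h := mul_le_mul_of_nonneg_left (hsH4.trans hc₀E) hE₀pos.le
      rw [mul_one_div, div_eq_mul_inv] at h
      calc E₀ * (s * (H : ℝ) ^ 4) ≤ E₀ * (4 * E₀)⁻¹ := h
        _ = 1 / 4 := by field_simp
    calc Real.exp ((15 + 27 * C₃) * (C₆ * s) * (Fintype.card (LandauFree H) : ℝ) / 2) ≤ Real.exp (1 / 4) :=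
          Real.exp_le_exp.2 (h1.trans h2)
      _ ≤ 3 := by
          have := Real.exp_one_lt_d9
          have h14 : Real.exp (1 / 4) ≤ Real.exp 1 := Real.exp_le_exp.2 (by norm_num)
          linarith
  have hCst288 : 288 * C₃ ≤ Cst := by
    have : 0 ≤ 2 * Real.exp (K₇p * 16) ^ 2 * Real.exp 216 * 3 := by positivity
    rw [hCst]; linarith only [this]
  have hCβ' : 288 * C₃ * (1 + Real.log H) ≤ β * s ^ 2 := (mul_le_mul_of_nonneg_right hCst288 (by linarith only [hlog])).trans hCβ
  have hq := six_card_exp_le_quarter hH hβpos.le (le_refl (0:ℝ)) hC₃pos (le_refl (288 * C₃)) hlog hCβ'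
  simp only [add_zero, mul_one] at hq
  -- assemble
  have hpM : p * Real.exp ((15 + 27 * C₃) * (C₆ * s) * (Fintype.card (LandauFree H) : ℝ) / 2) ≤ 1 / 4 := by
    calc p * _ ≤ 1 / 12 * 3 := mul_le_mul hp8 hMle (Real.exp_pos _).le (by norm_num)
      _ = 1 / 4 := by norm_num
  have hmain := sharp_event_assembly hK hD₀ (by positivity) hZp hp0 (Real.exp_pos _).le
    hU hCS hA1 hR1 hR3 hL hA0 hR2 hbox hq hpM
  -- the bracket is a constant: `K ≤ e^{16 K₇p}`, `G ≤ e^{216}`, `M ≤ 2`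
  have hKc : K ≤ Real.exp (K₇p * 16) := by
    refine Real.exp_le_exp.2 ?_
    have hL4 := GhostLogRatioProof.one_add_log_pow_four_le H hH
    have h16 := k_exponent_aux hs.le hL4 hsH hsH4 hc₀pos.le hc₀1
    have := mul_le_mul_of_nonneg_left h16 hK₇p0
    calc K₇p * (H : ℝ) ^ 4 * (1 + Real.log H) ^ 4 * s ^ 2 = K₇p * ((H : ℝ) ^ 4 * (1 + Real.log H) ^ 4 * s ^ 2) := by ring
      _ ≤ K₇p * 16 := this
  have hGc : Real.exp ((Fintype.card (LandauFree H) : ℝ) * ((s / 2) ^ 2 / 3 + (s / 2) ^ 4)) ≤ Real.exp 216 :=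
    Real.exp_le_exp.2 (g_exponent_aux hn hs.le hs1 (hsH4.trans hc₀1) hH')
  have hbr : 2 * K ^ 2 * Real.exp ((Fintype.card (LandauFree H) : ℝ) * ((s / 2) ^ 2 / 3 + (s / 2) ^ 4)) *
      Real.exp ((15 + 27 * C₃) * (C₆ * s) * (Fintype.card (LandauFree H) : ℝ) / 2) * Real.sqrt p ≤ Cst * Real.sqrt p := by
    refine mul_le_mul_of_nonneg_right ?_ (Real.sqrt_nonneg _)
    have h1 : K ^ 2 ≤ Real.exp (K₇p * 16) ^ 2 := pow_le_pow_left₀ hK.le hKc 2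
    calc 2 * K ^ 2 * Real.exp (↑(Fintype.card (LandauFree H)) * ((s / 2) ^ 2 / 3 + (s / 2) ^ 4)) *
          Real.exp ((15 + 27 * C₃) * (C₆ * s) * ↑(Fintype.card (LandauFree H)) / 2)
        ≤ 2 * Real.exp (K₇p * 16) ^ 2 * Real.exp 216 * 3 :=
          mul_le_mul (mul_le_mul (mul_le_mul_of_nonneg_left h1 (by norm_num)) hGc (Real.exp_pos _).le (by positivity)) hMle
            (Real.exp_pos _).le (by positivity)
      _ ≤ Cst := by rw [hCst]; linarith only [hC₃pos]
  have hIden : 0 ≤ ∫ a in smallField H (s / 2) \ A, fpChartWeight β H r a :=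
    setIntegral_nonneg ((ChartGauss.measurableSet_smallField _).diff hA) fun a _ => FPChart.fpChartWeight_nonneg β r a
  exact hmain.trans (mul_le_mul_of_nonneg_right hbr hIden)

end SmallFieldFPSharp

end Summit.QuantumFields.YangMills.Theorems.AllWindowsColdBoxBoxHighLine
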